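import Mathlib
import Summits.HodgeConjecture.HodgeConjecture.Theorems.SoloBlindFarLevels

/-!
# SoloBlindASDegTower — the AS-degenerate tower of WILD88/P4 (solo-blind s141)

WILD88, proviso P4, K-digit `δ` on a `ℤ/3`-eigenline (`det Ē₁(δ) = 0`).  Over
`k = 𝔽₅(θ)`, `θ⁴ = 2`, put `ω = 2 + 3θ² ∈ 𝔽₂₅` (`ω² + ω + 1 = 0`), `v₊ = (1, ω, ω²)`,
`v₋ = (1, ω², ω)` and write the satellite coordinate as `ũ = x v₊ + y v₋`, `δ = c v₊`.
Then `Ē₁(δ)` maps `v₊ ↦ c v₋`, `v₋ ↦ 0`, the Artin–Schreier equations decouple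
(`X : 4x⁵ + 3τx² + c x = 0`, `Y : 4y⁵ + 3τy² (+ c²σ⁴ y) = 0`), the order-9 node functional is
`f₉ = 3c²x + 3tc x² + t²(x³ + y³)`, and the special fibre of the satellite scheme is five fat
points `{x = 0 ∨ x⁴ = c} × {y⁵ = 0}` (memo HOME/work/s141/asdeg.md, claims SB-C1119 ff.).
This file certifies the finite / algebraic facts behind

* E-DEG-30 (`1/4 ≤ e < 1/3`): the label `3c²x` is injective, so level sets are single fat
  points of length `5`;
* CRIT-DEG-72 (`e = 1/3`, `τ = 1`): with `z = x + c` the `X`-polynomial is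
  `Z(z) = −z⁵ + 3z² + C`, `C = c²(c³ + 2)` (mod 5), and `Z ≡ (3 − w) z² + C (mod z³ − w)`, so a
  "circle" `z³ = w`, `w ∉ {0, 3}`, carries at most one root of `Z`; the level masses
  `2·I(w) + 3·I(w − 3)` are `≤ 5`, or `12, 9, 4` when `C = 0`;
* R3-DEG (`ρ < 1/4`): the label polynomials of the on-shell theorem have degree `≤ 3`, so a
  quadratic (cubic) label takes each value at most twice (three times) on distinct satellites;
  the cube-root satellites `ω^a y_c` are separated because `ω^{a+b}(ω^a + ω^b) = −1`
  (combined coefficient `2·(−1) − 1 = 2 ≠ 0`) and `ω^{2a}` are distinct; the `y_lin`-vs-centre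
  label is `(4·9 + 27) σ²⁰/t = 3σ²⁰/t ≠ 0`; and the valuation windows
  `ρ < 1/18 | 1/18 ≤ ρ < 1/6 | ρ = 1/6 | 1/6 < ρ < 1/4` with `v(σ) = ρ/4`, `v(t) = 1/4 − ρ`;
* the D-led findings of §5: `q₂ = Σ_{i<j}(Dᵢ − Dⱼ)² = 2ΣDᵢ² + 3ΣDᵢDⱼ` (mod 5) is anisotropic over
  `𝔽₅` and isotropic over `𝔽₂₅`, `q₂' = 3 q₂` (mod 5), `ε ↦ ε⁵` is additive on `𝔽₂₅`, and the
  level sets of `ε ↦ ε⁶` on `𝔽₂₅ˣ` have at most `6` points.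

`𝔽₂₅` is the pair model of `SoloBlindFarLevels` (`f25Mul`, `r² = 2`, `r = θ²`, so `ω = (2, 3)`).
Everything is `decide`, `ring`/`linear_combination`, or linear arithmetic over `ℚ`.
-/

namespace Summit.HodgeConjecture.HodgeConjecture.Theorems

/-! ## The cube root of unity `ω = 2 + 3θ²` in the pair model of `𝔽₂₅` -/

/-- `ω = 2 + 3r` (`r = θ²`, `r² = 2`). -/
def dtOmega : ZMod 5 × ZMod 5 := (2, 3)

/-- `ω² + ω + 1 = 0`. -/
theorem dtOmega_minpoly : f25Sq dtOmega + dtOmega + (1, 0) = 0 := by decide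

/-- `ω³ = 1`. -/
theorem dtOmega_cube : f25Mul dtOmega (f25Sq dtOmega) = (1, 0) := by decide

/-- Frobenius swaps the two primitive cube roots: `ω⁵ = ω²` (so `ũ⁵` swaps the eigenlines). -/
theorem dtOmega_frob : f25Pow5 dtOmega = f25Sq dtOmega := by decide

/-- `1, ω, ω²` are pairwise distinct, and so are their squares `1, ω², ω⁴ = ω`
(the three cube-root satellites `ω^a y_c` have distinct `y⁻²`). -/
theorem dtOmega_distinct :
    dtOmega ≠ (1, 0) ∧ f25Sq dtOmega ≠ (1, 0) ∧ dtOmega ≠ f25Sq dtOmega ∧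
      f25Sq (f25Sq dtOmega) = dtOmega := by
  decide

/-- The splitting constant of the cube-root satellites: `ω^{a+b}(ω^a + ω^b) = −1 = (4, 0)` for the
three pairs `{a, b} = {0,1}, {0,2}, {1,2}`. -/
theorem dtOmega_split :
    f25Mul dtOmega ((1, 0) + dtOmega) = (4, 0) ∧
      f25Mul (f25Sq dtOmega) ((1, 0) + f25Sq dtOmega) = (4, 0) ∧
        f25Mul (f25Mul dtOmega (f25Sq dtOmega)) (dtOmega + f25Sq dtOmega) = (4, 0) := by
  decide

/-- The same constant over any commutative ring containing a primitive cube root of unity. -/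
theorem dt_split_const {R : Type*} [CommRing R] (ω : R) (hω : ω ^ 2 + ω + 1 = 0) :
    ω * (1 + ω) = -1 ∧ ω ^ 2 * (1 + ω ^ 2) = -1 ∧ ω ^ 3 * (ω + ω ^ 2) = -1 := by
  refine ⟨?_, ?_, ?_⟩
  · linear_combination hω
  · linear_combination (ω ^ 2 - ω + 1) * hω
  · linear_combination (ω ^ 3 - ω + 1) * hω

/-- The combined coefficient of the cube-root label difference, `12·(−1) − 1 ≡ 2·(−1) − 1 = 2 ≠ 0`
in characteristic `5`; and the `y_lin`-vs-centre label `4·9 + 27 = 3 ≠ 0`, the `y_lin` balance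
`1 + 3·3 = 0` (`y_lin = 3σ³/t` solves `σ³ + 3 t y = 0`), and the small-pair shift `6 = 1`. -/
theorem dt_label_constants :
    (12 : ZMod 5) = 2 ∧ (2 * 4 - 1 : ZMod 5) = 2 ∧ (2 : ZMod 5) ≠ 0 ∧
      (4 * 9 + 27 : ZMod 5) = 3 ∧ (3 : ZMod 5) ≠ 0 ∧ (1 + 3 * 3 : ZMod 5) = 0 ∧
        (6 : ZMod 5) = 1 ∧ (4 : ZMod 5) = -1 := by
  decide

/-! ## The order-9 node functional and the E-strata (E-DEG-30) -/

/-- `t · f₉ = (t x + c)³ − c³ + t³ y³` for `f₉ = 3c²x + 3tc x² + t²(x³ + y³)`. -/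
theorem dt_f9_cube (R : Type*) [CommRing R] (t c x y : R) :
    t * (3 * c ^ 2 * x + 3 * t * c * x ^ 2 + t ^ 2 * (x ^ 3 + y ^ 3)) =
      (t * x + c) ^ 3 - c ^ 3 + t ^ 3 * y ^ 3 := by
  ring

/-- E-DEG-30: the leading label `x ↦ 3c²x` is injective when `3 ≠ 0` and `c ≠ 0`, so its level
sets on the five fat points `{x = xᵢ} × {y⁵ = 0}` are single fat points (length `5`). -/
theorem dt_linear_label_injective {F : Type*} [Field F] (c : F) (h3 : (3 : F) ≠ 0)
    (hc : c ≠ 0) : Function.Injective fun x : F => 3 * c ^ 2 * x := by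
  intro x₁ x₂ h
  have h' : 3 * c ^ 2 * x₁ = 3 * c ^ 2 * x₂ := h
  have hne : (3 : F) * c ^ 2 ≠ 0 := mul_ne_zero h3 (pow_ne_zero 2 hc)
  exact mul_left_cancel₀ hne h'

/-- Node arithmetic of the three strata of the degenerate tower:
E-DEG `6·5`, CRIT-DEG `6·12`, R3-DEG `25·3`, all `≤ 92`. -/
theorem dt_node_bounds : 6 * 5 ≤ 92 ∧ 6 * 12 ≤ 92 ∧ 25 * 3 ≤ 92 ∧ 25 * 3 = 75 := by decide

/-! ## The critical stratum: circles (CRIT-DEG-72) -/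

/-- The shift `z = x + c`: `x(−x⁴ + 3x + c) = −z⁵ + 3z² + c²(c³ + 2) + 5·(…)`. -/
theorem dt_shift_identity (R : Type*) [CommRing R] (z c : R) :
    (z - c) * (-(z - c) ^ 4 + 3 * (z - c) + c) =
      -z ^ 5 + 3 * z ^ 2 + c ^ 2 * (c ^ 3 + 2) +
        5 * (c * z ^ 4 - 2 * c ^ 2 * z ^ 3 + 2 * c ^ 3 * z ^ 2 - (c ^ 4 + c) * z) := by
  ring

/-- In characteristic `5` (hypothesis `5 = 0`): `x(−x⁴ + 3x + c) = Z(z) = −z⁵ + 3z² + C`,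
`C = c²(c³ + 2)`, with `x = z − c`. -/
theorem dt_shift_charFive {R : Type*} [CommRing R] (h5 : (5 : R) = 0) (z c : R) :
    (z - c) * (-(z - c) ^ 4 + 3 * (z - c) + c) = -z ^ 5 + 3 * z ^ 2 + c ^ 2 * (c ^ 3 + 2) := by
  rw [dt_shift_identity, h5]; ring

/-- Division by the circle equation: `Z(z) = (z³ − w)(−z²) + ((3 − w) z² + C)`. -/
theorem dt_circle_div (R : Type*) [CommRing R] (z w C : R) :
    -z ^ 5 + 3 * z ^ 2 + C = (z ^ 3 - w) * (-z ^ 2) + ((3 - w) * z ^ 2 + C) := by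
  ring

/-- A root of `Z` on the circle `z³ = w` satisfies `(3 − w) z² + C = 0`. -/
theorem dt_circle_root {R : Type*} [CommRing R] (z w C : R) (hz : z ^ 3 = w)
    (hZ : -z ^ 5 + 3 * z ^ 2 + C = 0) : (3 - w) * z ^ 2 + C = 0 := by
  linear_combination hZ + z ^ 2 * hz

/-- `I(w) ≤ 1` for `w ∉ {0, 3}` (in characteristic `≠ 2`): two roots of `Z` on the same circle
`z³ = w` coincide. -/
theorem dt_circle_unique {F : Type*} [Field F] (h2 : (2 : F) ≠ 0) (w C z₁ z₂ : F)
    (hw0 : w ≠ 0) (hw3 : w ≠ 3) (h₁ : z₁ ^ 3 = w) (h₂ : z₂ ^ 3 = w)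
    (hZ₁ : -z₁ ^ 5 + 3 * z₁ ^ 2 + C = 0) (hZ₂ : -z₂ ^ 5 + 3 * z₂ ^ 2 + C = 0) : z₁ = z₂ := by
  have e₁ := dt_circle_root z₁ w C h₁ hZ₁
  have e₂ := dt_circle_root z₂ w C h₂ hZ₂
  have hsq : (3 - w) * ((z₁ - z₂) * (z₁ + z₂)) = 0 := by linear_combination e₁ - e₂
  have h3w : (3 : F) - w ≠ 0 := sub_ne_zero.mpr (Ne.symm hw3)
  rcases mul_eq_zero.mp hsq with h | h
  · exact absurd h h3w
  rcases mul_eq_zero.mp h with h | h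
  · exact sub_eq_zero.mp h
  · exfalso
    have hz : z₁ = -z₂ := by linear_combination h
    have hw : 2 * w = 0 := by
      have : z₁ ^ 3 = -z₂ ^ 3 := by rw [hz]; ring
      linear_combination this - h₁ - h₂
    rcases mul_eq_zero.mp hw with h' | h'
    · exact h2 h'
    · exact hw0 h'

/-- If `C ≠ 0` then `z = 0` (i.e. `x = −c`) is not a root and the circle `w = 3` carries no root. -/
theorem dt_circle_C_ne_zero {F : Type*} [Field F] (C z : F) (hC : C ≠ 0) :
    (-(0 : F) ^ 5 + 3 * 0 ^ 2 + C ≠ 0) ∧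
      (z ^ 3 = 3 → -z ^ 5 + 3 * z ^ 2 + C ≠ 0) := by
  refine ⟨by simpa using hC, fun hz hZ => ?_⟩
  have := dt_circle_root z 3 C hz hZ
  exact hC (by simpa using this)

/-- If `C = 0` (`c³ = 3`): `Z = −z²(z³ − 3)`, so the roots are `z = 0` (double) and the circle
`z³ = 3` (three simple roots). -/
theorem dt_circle_C_zero {F : Type*} [Field F] (z : F) :
    -z ^ 5 + 3 * z ^ 2 + 0 = -z ^ 2 * (z ^ 3 - 3) ∧
      (-z ^ 5 + 3 * z ^ 2 + 0 = 0 ↔ z = 0 ∨ z ^ 3 = 3) := by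
  refine ⟨by ring, ?_⟩
  constructor
  · intro h
    have h' : -z ^ 2 * (z ^ 3 - 3) = 0 := by linear_combination h
    rcases mul_eq_zero.mp h' with h'' | h''
    · left; exact pow_eq_zero_iff (n := 2) (by norm_num) |>.mp (neg_eq_zero.mp h'')
    · right; exact sub_eq_zero.mp h''
  · rintro (h | h)
    · subst h; ring
    · linear_combination -z ^ 2 * h

/-- `C = c²(c³ + 2) = 0` iff `c = 0` or `c³ = 3` (i.e. `c³ = −2`) in characteristic `5`. -/
theorem dt_C_zero_iff {F : Type*} [Field F] (h5 : (5 : F) = 0) (c : F) :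
    c ^ 2 * (c ^ 3 + 2) = 0 ↔ c = 0 ∨ c ^ 3 = 3 := by
  have h32 : (3 : F) = -2 := by linear_combination h5
  constructor
  · intro h
    rcases mul_eq_zero.mp h with h | h
    · left; exact pow_eq_zero_iff (n := 2) (by norm_num) |>.mp h
    · right; rw [h32]; linear_combination h
  · rintro (h | h)
    · subst h; ring
    · rw [h32] at h; linear_combination c ^ 2 * h

/-- Level masses `M = 2·I(w) + 3·I(w − 3)` of the critical digit `(x + c)³ + y³ = κ'`
(`y = 0` double, `y³ = 3` three simple points): `≤ 5` when all `I ≤ 1` and `I(0) = I(3) = 0`;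
`12, 4, 9` for the three nonempty levels when `C = 0` (`I(3) = 3`, `I(0) = 2`, else `0`). -/
theorem dt_level_masses :
    2 * 1 + 3 * 1 ≤ 12 ∧ 2 * 3 + 3 * 2 = 12 ∧ 2 * 2 + 3 * 0 = 4 ∧ 2 * 0 + 3 * 3 = 9 ∧
      (4 : ℕ) ≤ 12 ∧ (9 : ℕ) ≤ 12 := by
  decide

/-! ## Regime III: label polynomials of degree ≤ 3 (R3-DEG) -/

/-- A quadratic label `a j² + b j` with `a ≠ 0` takes each value at most twice on distinct
satellites (window `1/18 ≤ ρ < 1/6`; at `ρ = 1/18` with `a = 4τ`, `b = γ̄ = 1`). -/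
theorem dt_quadratic_label {F : Type*} [Field F] (a b j₁ j₂ j₃ : F) (ha : a ≠ 0)
    (h12 : j₁ ≠ j₂) (h13 : j₁ ≠ j₃) (h23 : j₂ ≠ j₃)
    (e12 : a * j₁ ^ 2 + b * j₁ = a * j₂ ^ 2 + b * j₂)
    (e13 : a * j₁ ^ 2 + b * j₁ = a * j₃ ^ 2 + b * j₃) : False := by
  have f12 : (j₁ - j₂) * (a * (j₁ + j₂) + b) = 0 := by linear_combination e12
  have f13 : (j₁ - j₃) * (a * (j₁ + j₃) + b) = 0 := by linear_combination e13
  have g12 : a * (j₁ + j₂) + b = 0 := by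
    rcases mul_eq_zero.mp f12 with h | h
    · exact absurd (sub_eq_zero.mp h) h12
    · exact h
  have g13 : a * (j₁ + j₃) + b = 0 := by
    rcases mul_eq_zero.mp f13 with h | h
    · exact absurd (sub_eq_zero.mp h) h13
    · exact h
  have : a * (j₂ - j₃) = 0 := by linear_combination g12 - g13
  rcases mul_eq_zero.mp this with h | h
  · exact ha h
  · exact h23 (sub_eq_zero.mp h)

/-- A cubic label `a j³ + b j² + c j` with `a ≠ 0` takes each value at most three times on
distinct satellites (window `ρ = 1/6`: `τ² η³ + 4τ η²` on the roots of the satellite quintic). -/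
theorem dt_cubic_label {F : Type*} [Field F] (a b c j₁ j₂ j₃ j₄ : F) (ha : a ≠ 0)
    (h12 : j₁ ≠ j₂) (h13 : j₁ ≠ j₃) (h14 : j₁ ≠ j₄) (h23 : j₂ ≠ j₃) (h24 : j₂ ≠ j₄)
    (h34 : j₃ ≠ j₄)
    (e12 : a * j₁ ^ 3 + b * j₁ ^ 2 + c * j₁ = a * j₂ ^ 3 + b * j₂ ^ 2 + c * j₂)
    (e13 : a * j₁ ^ 3 + b * j₁ ^ 2 + c * j₁ = a * j₃ ^ 3 + b * j₃ ^ 2 + c * j₃)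
    (e14 : a * j₁ ^ 3 + b * j₁ ^ 2 + c * j₁ = a * j₄ ^ 3 + b * j₄ ^ 2 + c * j₄) : False := by
  have g : ∀ j : F, j₁ ≠ j →
      a * j₁ ^ 3 + b * j₁ ^ 2 + c * j₁ = a * j ^ 3 + b * j ^ 2 + c * j →
        a * (j₁ ^ 2 + j₁ * j + j ^ 2) + b * (j₁ + j) + c = 0 := by
    intro j hj e
    have f : (j₁ - j) * (a * (j₁ ^ 2 + j₁ * j + j ^ 2) + b * (j₁ + j) + c) = 0 := by
      linear_combination e
    rcases mul_eq_zero.mp f with h | h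
    · exact absurd (sub_eq_zero.mp h) hj
    · exact h
  have g12 := g j₂ h12 e12
  have g13 := g j₃ h13 e13
  have g14 := g j₄ h14 e14
  have k23 : (j₂ - j₃) * (a * (j₁ + j₂ + j₃) + b) = 0 := by linear_combination g12 - g13
  have k24 : (j₂ - j₄) * (a * (j₁ + j₂ + j₄) + b) = 0 := by linear_combination g12 - g14
  have l23 : a * (j₁ + j₂ + j₃) + b = 0 := by
    rcases mul_eq_zero.mp k23 with h | h
    · exact absurd (sub_eq_zero.mp h) h23
    · exact h
  have l24 : a * (j₁ + j₂ + j₄) + b = 0 := by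
    rcases mul_eq_zero.mp k24 with h | h
    · exact absurd (sub_eq_zero.mp h) h24
    · exact h
  have : a * (j₃ - j₄) = 0 := by linear_combination l23 - l24
  rcases mul_eq_zero.mp this with h | h
  · exact ha h
  · exact h34 (sub_eq_zero.mp h)

/-- Over the prime field the quadratic label bound by exhaustion: every level set of
`j ↦ a j² + b j` (`a ≠ 0`) in `𝔽₅` has at most two elements. -/
theorem dt_quadratic_label_F5 :
    ∀ a b v : ZMod 5, a ≠ 0 →
      (Finset.univ.filter fun j : ZMod 5 => a * j ^ 2 + b * j = v).card ≤ 2 := by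
  decide

/-! ## Valuation windows of regime III (`v(σ) = ρ/4`, `v(t) = 1/4 − ρ`) -/

/-- Window (A), `0 < ρ < 1/6`: `ε = t/σ²` has positive valuation; the `t¹` label `4tσ¹⁶j'²`
(`1/4 + 3ρ`) precedes the `t²` and the unknown `tσ¹⁸y^{1,2}` terms and ties the `t⁰` label
`σ³⁰j'` (`15ρ/2`) exactly at `ρ = 1/18`; the group digit `3jσ⁹` (`9ρ/4`) precedes everything. -/
theorem dt_window_A (ρ : ℚ) (h0 : 0 < ρ) (h6 : ρ < 1 / 6) :
    0 < 1 / 4 - 3 * ρ / 2 ∧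
      1 / 4 + 3 * ρ < 1 / 2 + 3 * ρ / 2 ∧ 1 / 4 + 3 * ρ < 1 / 4 + 15 * ρ / 4 ∧
        1 / 4 + 3 * ρ < 1 / 4 + 4 * ρ ∧ (15 * ρ / 2 < 1 / 4 + 3 * ρ ↔ ρ < 1 / 18) ∧
          9 * ρ / 4 < 15 * ρ / 2 ∧ 9 * ρ / 4 < 1 / 4 + 3 * ρ ∧ 1 / 4 + 3 * ρ < 3 / 4 ∧
            (ρ < 1 / 18 → 15 * ρ / 2 < 3 / 4) := by
  refine ⟨by linarith, by linarith, by linarith, by linarith, ?_, by linarith, by linarith,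
    by linarith, fun h => by linarith⟩
  constructor <;> intro h <;> linarith

/-- Window (B), `ρ = 1/6`: `v(t) = v(σ²)` and the cubic label `σ¹⁸(τ²η³ + 4τη²)` has valuation
`3/4 < 1`. -/
theorem dt_window_B : (1 : ℚ) / 4 - 1 / 6 = 2 * ((1 / 6) / 4) ∧ 18 * ((1 : ℚ) / 6) / 4 = 3 / 4 ∧
    (3 : ℚ) / 4 < 1 := by
  norm_num

/-- Window (C), `1/6 < ρ < 1/4`: the cube-root scale `ν_c = (1 − 3ρ)/12 > 0` is a Newton edge;
cube-root separations `7/12 + ρ` (`Φ ≠ 0`, first) and `5/12 + 2ρ` (`Φ = 0`) are `< 1`; small pair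
split at `1/2 + 3ρ/2 < min(1, 9ρ/2)`; `y_lin` vs centre at `6ρ − 1/4`, decisive iff `ρ < 5/24`;
cross-type term `3t³σ¹²` (`3/4`) isolated; ONE-GROUP `9ρ/4 < 9/16`; unknown terms later. -/
theorem dt_window_C (ρ : ℚ) (h6 : 1 / 6 < ρ) (h4 : ρ < 1 / 4) :
    0 < (1 - 3 * ρ) / 12 ∧ 1 / 4 - 3 * ρ / 4 < 3 / 5 * (1 / 4 - ρ / 4) ∧
      7 / 12 + ρ < 1 ∧ 5 / 12 + 2 * ρ < 1 ∧ 7 / 12 + ρ < 5 / 12 + 2 * ρ ∧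
        1 / 2 + 3 * ρ / 2 < 1 ∧ 1 / 2 + 3 * ρ / 2 < 9 * ρ / 2 ∧
          (6 * ρ - 1 / 4 < 1 ↔ ρ < 5 / 24) ∧ 3 / 4 < 6 * ρ - 1 / 4 ∧ 3 / 4 < 1 / 2 + 3 * ρ / 2 ∧
            9 * ρ / 4 < 9 / 16 ∧ (9 : ℚ) / 16 < 3 / 4 ∧
              5 / 12 + 2 * ρ < 1 / 3 + 13 * ρ / 4 ∧ 7 / 12 + ρ < 1 / 3 + 13 * ρ / 4 ∧
                5 / 12 + 2 * ρ < 5 / 12 + 3 * ρ := by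
  refine ⟨by linarith, by linarith, by linarith, by linarith, by linarith, by linarith,
    by linarith, ?_, by linarith, by linarith, by linarith, by norm_num, by linarith, by linarith,
    by linarith⟩
  constructor <;> intro h <;> linarith

/-- Valuation bookkeeping of window (C) (`ν_c = (1 − 3ρ)/12`): the decisive label terms have
valuations `7/12 + ρ`, `5/12 + 2ρ` (twice), `3/4`, `6ρ − 1/4`, `1/2 + 3ρ/2`. -/
theorem dt_window_C_vals (ρ : ℚ) :
    2 * (1 / 4 - ρ) + 11 * (ρ / 4) + (1 / 4 - ρ) + 3 * (ρ / 4) - 2 * ((1 - 3 * ρ) / 12)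
        = 7 / 12 + ρ ∧
      2 * (1 / 4 - ρ) + 15 * (ρ / 4) - (1 - 3 * ρ) / 12 = 5 / 12 + 2 * ρ ∧
        (1 / 4 - ρ) + 14 * (ρ / 4) + 2 * ((1 - 3 * ρ) / 12) = 5 / 12 + 2 * ρ ∧
          3 * (1 / 4 - ρ) + 12 * (ρ / 4) = 3 / 4 ∧ 20 * (ρ / 4) - (1 / 4 - ρ) = 6 * ρ - 1 / 4 ∧
            2 * (1 / 4 - ρ) + 14 * (ρ / 4) = 1 / 2 + 3 * ρ / 2 := by
  refine ⟨by ring, by ring, by ring, by ring, by ring, by ring⟩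

/-- E-strata placement (`λ = tσ³`, `v(σ) = e/4`, `v(t) = 1/4 − 3e/4`): for `e < 1/3` the
`t`-terms of `f₉` come strictly after the linear label `3c²x σ⁹` (`9e/4 < 3/4`). -/
theorem dt_window_E (e : ℚ) (h : e < 1 / 3) :
    0 < 1 / 4 - 3 * e / 4 ∧ 9 * e / 4 < 9 * e / 4 + (1 / 4 - 3 * e / 4) ∧ 9 * e / 4 < 3 / 4 := by
  refine ⟨by linarith, by linarith, by linarith⟩

/-! ## The second-block-led regime (§5 of the memo) -/

/-- Regime selection: the satellite scale is `v(u) = min(e_K/4, ρ_D/2, 1/12)`; the three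
pairwise comparisons. -/
theorem dt_regime_selection (e ρD : ℚ) :
    (e / 4 < ρD / 2 ↔ e < 2 * ρD) ∧ (e / 4 < 1 / 12 ↔ e < 1 / 3) ∧
      (ρD / 2 < 1 / 12 ↔ ρD < 1 / 6) := by
  refine ⟨?_, ?_, ?_⟩ <;> constructor <;> intro h <;> linarith

/-- D-led placement (`v(σ) = ρ_D/2`, `v(t) = 1/4 − 3ρ_D/2`): LEVEL A (`−θ⟨D̄,c̃⟩`, valuation
`ρ_D`) precedes every `u`-term (`≥ 1/4 + 3ρ_D`); the Q-channel `λ·3q₂·xy` (`1/4 + 3ρ_D`) precedes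
`λ²e₃` (`1/2 + 3ρ_D/2`) iff `ρ_D < 1/6`, and precedes the K-linear channel (`2e_K + ρ_D/2`)
iff `e_K > 1/8 + 5ρ_D/4`; and `2λK u²` (`1/4 + e_K + ρ_D`) comes after the Q-channel iff
`e_K > 2ρ_D`. -/
theorem dt_Dled_channels (e ρD : ℚ) (h0 : 0 < ρD) :
    ρD < 1 / 4 + 3 * ρD ∧ (1 / 4 + 3 * ρD < 1 / 2 + 3 * ρD / 2 ↔ ρD < 1 / 6) ∧
      (1 / 4 + 3 * ρD < 2 * e + ρD / 2 ↔ 1 / 8 + 5 * ρD / 4 < e) ∧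
        (1 / 4 + 3 * ρD < 1 / 4 + e + ρD ↔ 2 * ρD < e) ∧
          9 * (ρD / 2) + (1 / 4 - 3 * ρD / 2) = 1 / 4 + 3 * ρD := by
  refine ⟨by linarith, ?_, ?_, ?_, by ring⟩ <;> constructor <;> intro h <;> linarith

/-- `q₂(D) = Σ_{i<j}(Dᵢ − Dⱼ)² = 2ΣDᵢ² + 3Σ_{i<j}DᵢDⱼ − 5Σ_{i<j}DᵢDⱼ` (so the two agree mod 5),
and `3 q₂ = ΣDᵢ² + 4ΣDᵢDⱼ + 5(…)` (the coefficient `q₂'` of the `xy` channel is `3q₂` mod 5). -/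
theorem dt_q2_identities (R : Type*) [CommRing R] (a b c : R) :
    (a - b) ^ 2 + (a - c) ^ 2 + (b - c) ^ 2 =
        2 * (a ^ 2 + b ^ 2 + c ^ 2) + 3 * (a * b + a * c + b * c) - 5 * (a * b + a * c + b * c) ∧
      3 * (2 * (a ^ 2 + b ^ 2 + c ^ 2) + 3 * (a * b + a * c + b * c)) =
        (a ^ 2 + b ^ 2 + c ^ 2) + 4 * (a * b + a * c + b * c) +
          5 * ((a ^ 2 + b ^ 2 + c ^ 2) + (a * b + a * c + b * c)) := by
  constructor <;> ring

/-- On the traceless part (`c = −a − b`) the form is `q₂ = 6(a² + ab + b²)`, i.e.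
`a² + ab + b²` mod 5; it is ANISOTROPIC over `𝔽₅` … -/
theorem dt_q2_traceless (R : Type*) [CommRing R] (a b : R) :
    (a - b) ^ 2 + (a - (-a - b)) ^ 2 + (b - (-a - b)) ^ 2 =
      (a ^ 2 + a * b + b ^ 2) + 5 * (a ^ 2 + a * b + b ^ 2) := by
  ring

/-- … anisotropic over `𝔽₅` (so an isotropic leading digit `D̄` needs two independent
`𝔽₅`-components) … -/
theorem dt_q2_anisotropic_F5 : ∀ a b : ZMod 5, a ^ 2 + a * b + b ^ 2 = 0 → a = 0 ∧ b = 0 := by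
  decide

/-- … and isotropic over `𝔽₂₅`: `(a, b) = (1, ω)` gives `1 + ω + ω² = 0`. -/
theorem dt_q2_isotropic_F25 :
    f25Sq (1, 0) + f25Mul (1, 0) dtOmega + f25Sq dtOmega = 0 := by
  decide

/-- Sixth power in the pair model of `𝔽₂₅` (the Q-channel `xy = r²ε⁶` on `V_{q₂S}`). -/
def f25Pow6 (u : ZMod 5 × ZMod 5) : ZMod 5 × ZMod 5 := f25Mul u (f25Pow5 u)

/-- PROP D-LED-30, finite part: every level set of `ε ↦ ε⁶` on `𝔽₂₅ ∖ {0}` has at most `6`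
elements (and `ε⁶ = 0` only at `ε = 0`), so the Q-channel allows `≤ 6` nodes per active cluster. -/
theorem dt_pow6_levels :
    ∀ v : ZMod 5 × ZMod 5,
      (Finset.univ.filter fun e : ZMod 5 × ZMod 5 => e ≠ 0 ∧ f25Pow6 e = v).card ≤ 6 := by
  decide +kernel

/-- `ε⁶ = 0` only for `ε = 0` in `𝔽₂₅`. -/
theorem dt_pow6_eq_zero : ∀ e : ZMod 5 × ZMod 5, f25Pow6 e = 0 → e = 0 := by
  decide +kernel

/-- Frobenius `ε ↦ ε⁵` is additive on `𝔽₂₅` (so `αε + βε⁵` is `𝔽₅`-linear and its level sets are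
cosets of its kernel) … -/
theorem f25Pow5_add : ∀ u v : ZMod 5 × ZMod 5, f25Pow5 (u + v) = f25Pow5 u + f25Pow5 v := by
  decide +kernel

/-- … and the kernel of `ε ↦ αε + βε⁵` has at most `5` elements unless `α = β = 0`
(the linear channel of the window `2ρ_D < e_K ≤ 1/8 + 5ρ_D/4`). -/
theorem dt_linear_frobenius_kernel :
    ∀ α β : ZMod 5 × ZMod 5, (α, β) ≠ (0, 0) →
      (Finset.univ.filter fun e : ZMod 5 × ZMod 5 =>
          f25Mul α e + f25Mul β (f25Pow5 e) = 0).card ≤ 5 := by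
  decide +kernel

/-- Node arithmetic of PROP D-LED-30: `5` active clusters on a line times `6`, and the isotropic
case `25`, are `≤ 92`. -/
theorem dt_Dled_bound : 5 * 6 ≤ 92 ∧ 25 ≤ 92 ∧ 5 * 6 = 30 := by decide

end Summit.HodgeConjecture.HodgeConjecture.Theorems
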